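import Mathlib
import Summits.Ventures.PercRepro2.SwOutCrossGenProdThm

/-!
# The product of two dropped components: the non-core step and the assembly (blind cell
PercRepro2, night-4 g24, 2026-08-28; proofs/NIGHT4-G24.md §11)

**Step 3** (`card_nc_leP`): a non-leaking product point whose second component is not core lies on
the T-slab (all u-arms red; then its red count enters) or on the B-slab (all u-arms blue; then its
red atoms are empty).  The T-slab points inject into the B-slab points through
`(sTop, w₁, w₂) ↦ (sBot, theta₁ w₁, psi₂ w₂)`; the image is not core in the second component
(`psi_ok`), so the split of the count by the core of the second component is respected.

**Assembly** (`ineq_prod_aux`): the red count is at most the blue count on every up-set of types,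
for every up-set of atom sets — by the split core / non-core of the second component, the frozen
inequality (`card_frozen_leP`) fibred over the core, the pairing (`card_pairP_le`) fibred over the
points of the first cube, and the slab injection.
-/

namespace Summit.Ventures.PercRepro2

namespace CrossArm

section NonCore

variable {W₁ A₁ L₁ W₂ A₂ L₂ : Type*} {ι : Type*} (F₁ : FibreIter W₁ A₁ L₁) (F₂ : FibreDataBit W₂ A₂ L₂)

/-- A non-leaking product point whose second component is not core has all u-arms red or all
u-arms blue. -/
lemma top_or_bot_P {x : PtP W₁ W₂ ι} (hx : ¬ LeakP F₁ F₂ x) (hc : F₂.core x.2.2 = false) :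
    x.1 = sTopG ∨ x.1 = sBotG := by
  by_contra h
  have hnt : x.1 ≠ sTopG := fun h' => h (Or.inl h')
  have hnb : x.1 ≠ sBotG := fun h' => h (Or.inr h')
  have hr : redUG x.1 := by
    by_contra hr
    apply hnb
    funext j
    cases hj : x.1 j with
    | true => exact absurd ⟨j, hj⟩ hr
    | false => rfl
  have hb : blueUG x.1 := by
    by_contra hb
    apply hnt
    funext j
    cases hj : x.1 j with
    | false => exact absurd ⟨j, hj⟩ hb
    | true => rfl
  have h1 : F₂.leakR x.2.2 = false := by
    cases hL : F₂.leakR x.2.2 with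
    | false => rfl
    | true => exact absurd (Or.inr (Or.inl ⟨hr, hL⟩)) hx
  have h2 : F₂.leakR (F₂.flip x.2.2) = false := by
    cases hL : F₂.leakR (F₂.flip x.2.2) with
    | false => rfl
    | true => exact absurd (Or.inr (Or.inr ⟨hb, hL⟩)) hx
  have := F₂.core_of_noLeak x.2.2 h1 h2
  rw [hc] at this
  exact Bool.noConfusion this

/-- On the B-slab the red atoms are empty. -/
lemma ERP_sBot (w₁ : W₁) (w₂ : W₂) : ERP F₁ F₂ ((sBotG : Config ι), w₁, w₂) = ∅ := by
  simp only [ERP]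
  have h1 : ERI F₁ ((sBotG : Config ι), w₁) = ∅ := ERI_sBot F₁ w₁
  rw [h1, Set.image_empty, Set.empty_union]
  ext a
  simp only [Set.mem_setOf_eq, Set.mem_empty_iff_false, iff_false, not_exists, not_and]
  intro _ _ h _
  exact not_redUG_bot h

/-- On the T-slab the blue atoms are empty. -/
lemma EBP_sTop (w₁ : W₁) (w₂ : W₂) : EBP F₁ F₂ ((sTopG : Config ι), w₁, w₂) = ∅ := by
  show ERP F₁ F₂ (flipAll (sTopG : Config ι), F₁.flip w₁, F₂.flip w₂) = ∅
  rw [flipAll_sTopG]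
  exact ERP_sBot F₁ F₂ _ _

/-- The red atoms are monotone in the fibre points, at a fixed u-arm configuration. -/
lemma ERP_mono_fib {s : Config ι} {w₁ w₁' : W₁} {w₂ w₂' : W₂}
    (h₁ : ∀ a, F₁.red w₁ a = true → F₁.red w₁' a = true)
    (h₂ : ∀ a, F₂.red w₂ a = true → F₂.red w₂' a = true) :
    ERP F₁ F₂ (s, w₁, w₂) ⊆ ERP F₁ F₂ (s, w₁', w₂') := by
  rintro b (⟨a, ha, rfl⟩ | ⟨a, rfl, hs, ha⟩)
  · refine Or.inl ⟨a, ?_, rfl⟩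
    rcases a with j | (u | a)
    · exact ha
    · exact ha
    · exact ⟨ha.1, h₁ a ha.2⟩
  · exact Or.inr ⟨a, rfl, hs, h₂ a ha⟩

variable [Fintype ι] [DecidableEq ι] [Fintype W₁] [DecidableEq W₁] [Fintype W₂] [DecidableEq W₂]

open scoped Classical

variable [Nonempty ι]

omit [DecidableEq W₁] [DecidableEq W₂] in
/-- **Step 3, the non-core points of the second component**: the red T-slab points inject into
the blue B-slab points through `theta₁ × psi₂`. -/
lemma card_nc_leP {𝒯 : Set (TypP L₁ L₂ ι)} (h𝒯 : IsUpP F₁ F₂ 𝒯) {𝓔 : Set (Set (AtomPr A₁ A₂ ι))}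
    (h𝓔 : IsUpperSet 𝓔) (hE : (∅ : Set (AtomPr A₁ A₂ ι)) ∉ 𝓔) :
    ((QP F₁ F₂ 𝒯).filter fun x => F₂.core x.2.2 = false ∧ ERP F₁ F₂ x ∈ 𝓔).card ≤
      ((QP F₁ F₂ 𝒯).filter fun x => F₂.core x.2.2 = false ∧ EBP F₁ F₂ x ∈ 𝓔).card := by
  -- every point of the left side is a T-slab point without red-side leak
  have hform : ∀ x ∈ (QP F₁ F₂ 𝒯).filter fun x => F₂.core x.2.2 = false ∧ ERP F₁ F₂ x ∈ 𝓔,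
      x.1 = sTopG ∧ F₁.leakR x.2.1 = false ∧ F₂.leakR x.2.2 = false := by
    intro x hx
    rw [Finset.mem_filter] at hx
    obtain ⟨hx, hc, hE'⟩ := hx
    have hl := ((mem_QP F₁ F₂).1 hx).1
    have hs : x.1 = sTopG := by
      rcases top_or_bot_P F₁ F₂ hl hc with hs | hs
      · exact hs
      · exfalso
        have : ERP F₁ F₂ x = ∅ := by
          rw [show x = (x.1, x.2.1, x.2.2) from rfl, hs]
          exact ERP_sBot F₁ F₂ _ _
        rw [this] at hE'
        exact hE hE'
    refine ⟨hs, ?_, ?_⟩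
    · cases h : F₁.leakR x.2.1 with
      | false => rfl
      | true =>
        exfalso
        exact hl (Or.inl (Or.inl ⟨by rw [hs]; exact redUG_top, h⟩))
    · cases h : F₂.leakR x.2.2 with
      | false => rfl
      | true =>
        exfalso
        exact hl (Or.inr (Or.inl ⟨by rw [hs]; exact redUG_top, h⟩))
  refine Finset.card_le_card_of_injOn
    (fun x => ((sBotG : Config ι), F₁.theta x.2.1, F₂.psi x.2.2)) ?_ ?_
  · intro x hx
    rw [Finset.mem_coe] at hx ⊢
    obtain ⟨hs, hl₁, hl₂⟩ := hform x hx
    have hx' := hx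
    rw [Finset.mem_filter] at hx' ⊢
    obtain ⟨hxQ, hc, hE'⟩ := hx'
    obtain ⟨hθl, hθlab, hθred⟩ := F₁.theta_ok x.2.1 hl₁
    obtain ⟨hψl, hψc, hψlab, hψred⟩ := F₂.psi_ok x.2.2 hl₂ hc
    refine ⟨?_, hψc, ?_⟩
    · rw [mem_QP]
      refine ⟨?_, ?_⟩
      · rintro ((⟨⟨j, hj⟩, -⟩ | ⟨-, h2⟩) | ⟨⟨j, hj⟩, -⟩ | ⟨-, h3⟩)
        · exact Bool.noConfusion hj
        · rw [hθl] at h2; exact Bool.noConfusion h2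
        · exact Bool.noConfusion hj
        · rw [hψl] at h3; exact Bool.noConfusion h3
      · have ht := ((mem_QP F₁ F₂).1 hxQ).2
        have ht' : (x.1, F₁.label x.2.1, F₂.label x.2.2) ∈ 𝒯 := ht
        show ((sBotG : Config ι), F₁.label (F₁.theta x.2.1), F₂.label (F₂.psi x.2.2)) ∈ 𝒯
        refine h𝒯 _ ht' _ ⟨fun j hj => ?_, hθlab, hψlab⟩
        have hj' : x.1 j = false := hj
        rw [hs] at hj'
        exact Bool.noConfusion hj'
    · -- the blue atoms of the image contain the red atoms of the source
      show ERP F₁ F₂ (flipAll (sBotG : Config ι), F₁.flip (F₁.theta x.2.1),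
        F₂.flip (F₂.psi x.2.2)) ∈ 𝓔
      rw [flipAll_sBotG]
      have hER : ERP F₁ F₂ x = ERP F₁ F₂ ((sTopG : Config ι), x.2.1, x.2.2) := by
        rw [show x = (x.1, x.2.1, x.2.2) from rfl, hs]
      rw [hER] at hE'
      exact h𝓔 (ERP_mono_fib F₁ F₂ hθred hψred) hE'
  · intro x hx y hy hxy
    rw [Finset.mem_coe] at hx hy
    obtain ⟨hsx, hlx₁, hlx₂⟩ := hform x hx
    obtain ⟨hsy, hly₁, hly₂⟩ := hform y hy
    have hcx : F₂.core x.2.2 = false := (Finset.mem_filter.1 hx).2.1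
    have hcy : F₂.core y.2.2 = false := (Finset.mem_filter.1 hy).2.1
    simp only [Prod.mk.injEq, true_and] at hxy
    have hw₁ := F₁.theta_inj _ _ hlx₁ hly₁ hxy.1
    have hw₂ := F₂.psi_inj _ _ hlx₂ hcx hly₂ hcy hxy.2
    rw [show x = (x.1, x.2.1, x.2.2) from rfl, show y = (y.1, y.2.1, y.2.2) from rfl, hsx, hsy,
      hw₁, hw₂]

end NonCore

section Assembly

variable {W₁ A₁ L₁ W₂ A₂ L₂ : Type*} {ι : Type*} (F₁ : FibreIter W₁ A₁ L₁) (F₂ : FibreDataBit W₂ A₂ L₂)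
variable [Fintype ι] [DecidableEq ι] [Fintype W₁] [DecidableEq W₁] [Fintype W₂] [DecidableEq W₂]

open scoped Classical

variable [Nonempty ι]

omit [DecidableEq W₁] in
/-- **THE ABSTRACT THEOREM OF BOUNDARY (iv) FOR THE PRODUCT OF TWO COMPONENTS**: on every
up-set of product types, the red count is at most the blue count for every up-set of atom sets,
given the inequality of the first factor. -/
theorem ineq_prod_aux (hineq : Ineq F₁ (ι := ι)) {𝒯 : Set (TypP L₁ L₂ ι)} (h𝒯 : IsUpP F₁ F₂ 𝒯)
    {𝓔 : Set (Set (AtomPr A₁ A₂ ι))} (h𝓔 : IsUpperSet 𝓔) :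
    ((QP F₁ F₂ 𝒯).filter fun x => ERP F₁ F₂ x ∈ 𝓔).card ≤
      ((QP F₁ F₂ 𝒯).filter fun x => EBP F₁ F₂ x ∈ 𝓔).card := by
  by_cases hE : (∅ : Set (AtomPr A₁ A₂ ι)) ∈ 𝓔
  · have hall : ∀ S : Set (AtomPr A₁ A₂ ι), S ∈ 𝓔 := fun S => h𝓔 (Set.empty_subset S) hE
    rw [Finset.filter_true_of_mem fun _ _ => hall _, Finset.filter_true_of_mem fun _ _ => hall _]
  -- split both sides along the core of the second component
  have hR := Finset.card_filter_add_card_filter_not (s := (QP F₁ F₂ 𝒯).filter fun x => ERP F₁ F₂ x ∈ 𝓔)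
    (fun x => F₂.core x.2.2 = true)
  have hB := Finset.card_filter_add_card_filter_not (s := (QP F₁ F₂ 𝒯).filter fun x => EBP F₁ F₂ x ∈ 𝓔)
    (fun x => F₂.core x.2.2 = true)
  simp only [Finset.filter_filter] at hR hB
  -- the non-core points
  have hnc := card_nc_leP F₁ F₂ h𝒯 h𝓔 hE
  have hcf : ∀ c : Bool, ¬ c = true ↔ c = false := fun c => by cases c <;> simp
  have ex1 : ((QP F₁ F₂ 𝒯).filter fun x => ERP F₁ F₂ x ∈ 𝓔 ∧ ¬ F₂.core x.2.2 = true) =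
      (QP F₁ F₂ 𝒯).filter fun x => F₂.core x.2.2 = false ∧ ERP F₁ F₂ x ∈ 𝓔 :=
    Finset.filter_congr fun x _ => by rw [hcf, and_comm]
  have ex2 : ((QP F₁ F₂ 𝒯).filter fun x => EBP F₁ F₂ x ∈ 𝓔 ∧ ¬ F₂.core x.2.2 = true) =
      (QP F₁ F₂ 𝒯).filter fun x => F₂.core x.2.2 = false ∧ EBP F₁ F₂ x ∈ 𝓔 :=
    Finset.filter_congr fun x _ => by rw [hcf, and_comm]
  rw [ex1] at hR
  rw [ex2] at hB
  -- the core points: fibre by the point of the second component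
  have c1 : ((QP F₁ F₂ 𝒯).filter fun x => ERP F₁ F₂ x ∈ 𝓔 ∧ F₂.core x.2.2 = true).card =
      ∑ c ∈ coreAll F₂.toFibreData, ((QP F₁ F₂ 𝒯).filter fun x => x.2.2 = c ∧ ERP F₁ F₂ x ∈ 𝓔).card := by
    rw [Finset.card_eq_sum_card_fiberwise (f := fun x => x.2.2) (t := coreAll F₂.toFibreData)
      (fun x hx => mem_coreAll_of_core (Finset.mem_filter.1 hx).2.2)]
    refine Finset.sum_congr rfl fun c hc => ?_
    rw [Finset.filter_filter]
    congr 1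
    apply Finset.filter_congr
    intro x _
    constructor
    · rintro ⟨⟨hE', -⟩, hc'⟩
      exact ⟨hc', hE'⟩
    · rintro ⟨hc', hE'⟩
      exact ⟨⟨hE', by rw [hc']; exact core_of_mem_coreAll F₂ hc⟩, hc'⟩
  have c2 : ((QP F₁ F₂ 𝒯).filter fun x => F₂.core x.2.2 = true ∧ EBpreP F₁ F₂ x.2.2 x ∈ 𝓔).card =
      ∑ c ∈ coreAll F₂.toFibreData,
        ((QP F₁ F₂ 𝒯).filter fun x => x.2.2 = c ∧ EBpreP F₁ F₂ c x ∈ 𝓔).card := by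
    rw [Finset.card_eq_sum_card_fiberwise (f := fun x => x.2.2) (t := coreAll F₂.toFibreData)
      (fun x hx => mem_coreAll_of_core (Finset.mem_filter.1 hx).2.1)]
    refine Finset.sum_congr rfl fun c hc => ?_
    rw [Finset.filter_filter]
    congr 1
    apply Finset.filter_congr
    intro x _
    constructor
    · rintro ⟨⟨-, hE'⟩, hc'⟩
      refine ⟨hc', ?_⟩
      rw [← hc']; exact hE'
    · rintro ⟨hc', hE'⟩
      refine ⟨⟨by rw [hc']; exact core_of_mem_coreAll F₂ hc, ?_⟩, hc'⟩
      rw [hc']; exact hE'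
  have c3 : ((QP F₁ F₂ 𝒯).filter fun x => F₂.core x.2.2 = true ∧ EBpreP F₁ F₂ x.2.2 x ∈ 𝓔).card =
      ∑ q : PtG W₁ ι, ((QP F₁ F₂ 𝒯).filter fun x =>
        (x.1, x.2.1) = q ∧ F₂.core x.2.2 = true ∧ EBpreP F₁ F₂ x.2.2 x ∈ 𝓔).card := by
    rw [Finset.card_eq_sum_card_fiberwise (f := fun x => (x.1, x.2.1)) (t := Finset.univ)
      (fun _ _ => Finset.mem_univ _)]
    refine Finset.sum_congr rfl fun q _ => ?_
    rw [Finset.filter_filter]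
    congr 1
    apply Finset.filter_congr
    intro x _
    exact and_comm
  have c4 : ((QP F₁ F₂ 𝒯).filter fun x => EBP F₁ F₂ x ∈ 𝓔 ∧ F₂.core x.2.2 = true).card =
      ∑ q : PtG W₁ ι, ((QP F₁ F₂ 𝒯).filter fun x =>
        (x.1, x.2.1) = q ∧ F₂.core x.2.2 = true ∧ EBP F₁ F₂ x ∈ 𝓔).card := by
    rw [Finset.card_eq_sum_card_fiberwise (f := fun x => (x.1, x.2.1)) (t := Finset.univ)
      (fun _ _ => Finset.mem_univ _)]
    refine Finset.sum_congr rfl fun q _ => ?_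
    rw [Finset.filter_filter]
    congr 1
    apply Finset.filter_congr
    intro x _
    constructor
    · rintro ⟨⟨hE', hc⟩, hq⟩
      exact ⟨hq, hc, hE'⟩
    · rintro ⟨hq, hc, hE'⟩
      exact ⟨⟨hE', hc⟩, hq⟩
  have hcore : ((QP F₁ F₂ 𝒯).filter fun x => ERP F₁ F₂ x ∈ 𝓔 ∧ F₂.core x.2.2 = true).card ≤
      ((QP F₁ F₂ 𝒯).filter fun x => EBP F₁ F₂ x ∈ 𝓔 ∧ F₂.core x.2.2 = true).card :=
    calc ((QP F₁ F₂ 𝒯).filter fun x => ERP F₁ F₂ x ∈ 𝓔 ∧ F₂.core x.2.2 = true).card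
        = ∑ c ∈ coreAll F₂.toFibreData,
            ((QP F₁ F₂ 𝒯).filter fun x => x.2.2 = c ∧ ERP F₁ F₂ x ∈ 𝓔).card := c1
      _ ≤ ∑ c ∈ coreAll F₂.toFibreData,
            ((QP F₁ F₂ 𝒯).filter fun x => x.2.2 = c ∧ EBpreP F₁ F₂ c x ∈ 𝓔).card :=
          Finset.sum_le_sum fun c hc =>
            card_frozen_leP F₁ F₂ hineq h𝒯 h𝓔 c (core_of_mem_coreAll F₂ hc)
      _ = ((QP F₁ F₂ 𝒯).filter fun x => F₂.core x.2.2 = true ∧ EBpreP F₁ F₂ x.2.2 x ∈ 𝓔).card :=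
          c2.symm
      _ = ∑ q : PtG W₁ ι, ((QP F₁ F₂ 𝒯).filter fun x =>
            (x.1, x.2.1) = q ∧ F₂.core x.2.2 = true ∧ EBpreP F₁ F₂ x.2.2 x ∈ 𝓔).card := c3
      _ ≤ ∑ q : PtG W₁ ι, ((QP F₁ F₂ 𝒯).filter fun x =>
            (x.1, x.2.1) = q ∧ F₂.core x.2.2 = true ∧ EBP F₁ F₂ x ∈ 𝓔).card :=
          Finset.sum_le_sum fun q _ => card_pairP_le F₁ F₂ h𝒯 h𝓔 q
      _ = ((QP F₁ F₂ 𝒯).filter fun x => EBP F₁ F₂ x ∈ 𝓔 ∧ F₂.core x.2.2 = true).card := c4.symm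
  omega

end Assembly

end CrossArm

end Summit.Ventures.PercRepro2
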